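import Summits.ResolutionOfSingularities.ResolutionOfSingularities.Theses.DefectlessFrames
import Literature.AlgebraicGeometry.Resolution.ValuationDefectExample

/-!
# `PureTranscendentalFrames` — negative lemmas II: re-framing and the axis guard are load-bearing

Support (negative) lemmas for crux `stmt-ResolutionOfSingularities-18874`
(`…Theses.DefectlessFrames.PureTranscendentalFrames`; see `LoadBearing.lean` in this directory for
the statement in words and the `n = 0` lemmas), filed by the standing disprover (cdisprove cycle 1;
work file `Cruxes/PureTranscendentalFrames/Disproof.lean`). This file supplies the first
TWO-ELEMENT frames in Lean — a zero-dimensional rank-one place on a function field of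
transcendence degree 2 — and uses them against two natural strengthenings of the crux. No
definition is declared; every variant statement is the crux written out verbatim with one clause
edited, and no declaration concludes the route decl positively.

* MODEL (§2). `𝕄 = 𝔽_p((X))` with its `X`-adic valuation; `z₁, z₂ ∈ 𝕄` algebraically independent
  over `𝔽_p` and of positive value (`exists_frame_laurentSeries`: a cardinality count — over the
  countable fields `𝔽_p(X)` and `𝔽_p(z₁)` some Laurent series is transcendental
  (`exists_transcendental_laurentSeries` of `ValuationDefectExample.lean`), normalised into the
  maximal ideal by `exists_transcendental_of_valuation_lt`); `K = 𝔽_p(z₁, z₂) ⊆ 𝕄` (an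
  intermediate field, so finitely generated: `fg_top_adjoin`) with the restricted valuation ring
  `O = K ∩ 𝔽_p⟦X⟧` (`Valued.v.valuationSubring.comap`), which contains the constants
  (`const_mem_comap`), is rank one (`rankOne_comap`, via `isEquiv_comap`) and residually rational
  (`zeroDim_comap`: `x ≡ x(0) (mod 𝔪)`). The frame `x = (z₁, z₂)` is algebraically independent and
  `z₁ ∈ 𝔪_O`, so for `g = X₀` the axis polynomial `axis 1 x g = C(z̄₁)` VANISHES
  (`axis_X_zero_eq_zero`): `x` is not in general position.
* BOOKKEEPING (§1, reusable by provers). `eval_residue_axis`: the crux's axis polynomial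
  `axis m w G = G(w̄₀,…,w̄ₘ₋₁, X)` evaluated at `X = w̄ₘ` is the residue of `G(w) ∈ O`;
  `coe_eval₂_codRestrict`: that `G(w) ∈ O` coerces to the crux's `MvPolynomial.aeval (w : K) G`.
* `not_pureTranscendentalFrames_noReframing` — the strengthening "the given frame already works"
  (`x' := x`, `G := g`: conclusion `axis n x g ≠ 0 ∧ purity of xₙ over k(x_{<n})`) is FALSE at the
  frame above. So the existential re-framing `∃ x'` is load-bearing: general position must be
  PRODUCED (on paper it always can be, by the Frobenius–Nagata twist `x'ᵢ = xᵢ + xₙ^{p^{eᵢ}}` —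
  see the work file), it is not automatic.
* `not_pureTranscendentalFrames_unguardedAxis` — deleting the guard `axis n x g ≠ 0 →` of the
  axis-order clause is FALSE: Mathlib's `rootMultiplicity _ 0 = 0`, so at a frame that is not in
  general position the unguarded clause forces `rootMultiplicity (axis 1 x' G) x̄'₁ = 0`, i.e.
  `G(x')` a unit of `O`; but `G(x') = g(x) = z₁ ∈ 𝔪`. So the guard is exactly right: the axis
  order of a frame that is not in general position carries no information (Zariski defines it only
  after general position has been reached).

Purity plays no role here: over the co-frame field `k(x'₀)` of a two-element frame the valuation
is discrete and purity is automatic (work file, "Why it resists" 2); a purity witness needs `n ≥ 2`.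
Sources: O. Zariski, *Local uniformization on algebraic varieties*, Ann. of Math. 41 (1940)
852–896, A.IV, C.I (general position; the axis order `s`); F. K. Schmidt's discrete rank-one
places of function fields inside `k((X))` (folklore; ambient = `ValuationDefectExample.lean`).
-/

noncomputable section

set_option linter.dupNamespace false -- mandated namespace of this single-conjunct summit

open scoped LaurentSeries
open Polynomial IntermediateField WithZero IsLocalRing
open Literature.AlgebraicGeometry.Resolution

namespace Summit.ResolutionOfSingularities.ResolutionOfSingularities.Theorems.PureTranscendentalFrames.Negative

/-! ## §1 Bookkeeping: the axis polynomial evaluated at the last residue -/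

section Axis
variable {k K : Type} [Field k] [Field K] [Algebra k K] (O : ValuationSubring K)
  (hk : ∀ c : k, algebraMap k K c ∈ O)

/-- The crux's axis polynomial `axis m w G = G(w̄₀,…,w̄ₘ₋₁, X)` evaluated at `X = w̄ₘ` is the
residue of `G(w) ∈ O`. [folklore] -/
theorem eval_residue_axis (m : ℕ) (w : Fin (m + 1) → O) (G : MvPolynomial (Fin (m + 1)) k) :
    Polynomial.eval (residue O (w (Fin.last m)))
      (MvPolynomial.eval₂ (Polynomial.C.comp ((residue O).comp ((algebraMap k K).codRestrict O hk)))
        (Fin.snoc (fun j => Polynomial.C (residue O (w (Fin.castSucc j)))) Polynomial.X) G) =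
    residue O (MvPolynomial.eval₂ ((algebraMap k K).codRestrict O hk) w G) := by
  rw [show Polynomial.eval (residue O (w (Fin.last m))) = Polynomial.evalRingHom _ from rfl,
    MvPolynomial.eval₂_comp_left, MvPolynomial.eval₂_comp_left (residue O)]
  congr 1
  · ext a
    simp
  · funext i
    refine Fin.lastCases ?_ (fun j => ?_) i
    · simp
    · simp

/-- The element `G(w) ∈ O` coerces to `G(w) ∈ K` (the crux's
`MvPolynomial.aeval (fun i => (w i : K)) G`). [folklore] -/
theorem coe_eval₂_codRestrict (m : ℕ) (w : Fin (m + 1) → O) (G : MvPolynomial (Fin (m + 1)) k) :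
    ((MvPolynomial.eval₂ ((algebraMap k K).codRestrict O hk) w G : O) : K) =
      MvPolynomial.aeval (fun i => (w i : K)) G := by
  rw [show ((MvPolynomial.eval₂ ((algebraMap k K).codRestrict O hk) w G : O) : K) =
      O.subtype (MvPolynomial.eval₂ ((algebraMap k K).codRestrict O hk) w G) from rfl,
    MvPolynomial.eval₂_comp_left, MvPolynomial.aeval_def]
  rfl

end Axis

/-! ## §2 The model: `𝔽_p(z₁, z₂) ⊆ 𝔽_p((X))` with the `X`-adic place -/

section LaurentModel
variable (p : ℕ) [hp : Fact p.Prime]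

/-- Normalisation: over any subfield `F ⊆ 𝔽_p((X))` containing some `c ≠ 0` of positive value, a
transcendental Laurent series can be replaced by one of positive value (`c·z` or `c·z⁻¹`).
[folklore] -/
theorem exists_transcendental_of_valuation_lt (F : IntermediateField (ZMod p) ((ZMod p)⸨X⸩))
    {c : (ZMod p)⸨X⸩} (hcF : c ∈ F) (hc0 : c ≠ 0) (hc : Valued.v c < (1 : ℤᵐ⁰))
    {z : (ZMod p)⸨X⸩} (hz : Transcendental (↥F) z) :
    ∃ z' : (ZMod p)⸨X⸩, Valued.v z' < (1 : ℤᵐ⁰) ∧ Transcendental (↥F) z' := by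
  have hcalg : IsAlgebraic (↥F) c := isAlgebraic_algebraMap (⟨c, hcF⟩ : ↥F)
  have hcnz : c ∈ nonZeroDivisors ((ZMod p)⸨X⸩) := mem_nonZeroDivisors_of_ne_zero hc0
  rcases le_or_gt (Valued.v z) (1 : ℤᵐ⁰) with hv | hv
  · refine ⟨c * z, ?_, fun halg => hz (hcalg.of_mul hcnz halg)⟩
    rw [map_mul]
    exact (mul_le_of_le_one_right' hv).trans_lt hc
  · have hz0 : z ≠ 0 := by rintro rfl; simp at hv
    refine ⟨c * z⁻¹, ?_, fun halg => ?_⟩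
    · rw [map_mul, map_inv₀]
      exact (mul_le_of_le_one_right' (inv_le_one_of_one_le₀ hv.le)).trans_lt hc
    · exact hz (IsAlgebraic.inv_iff.mp (hcalg.of_mul hcnz halg))

/-- Two algebraically independent Laurent series of positive value: `z₁` transcendental over
`𝔽_p(X)` and `z₂` transcendental over `𝔽_p(z₁)` exist by a cardinality count
(`exists_transcendental_laurentSeries`), normalised into the maximal ideal. [folklore] -/
theorem exists_frame_laurentSeries :
    ∃ z₁ z₂ : (ZMod p)⸨X⸩, Valued.v z₁ < (1 : ℤᵐ⁰) ∧ Valued.v z₂ < (1 : ℤᵐ⁰) ∧ z₁ ≠ 0 ∧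
      AlgebraicIndependent (ZMod p) ![z₁, z₂] := by
  -- `T = X`, of value `exp (-1) < 1`
  set T : (ZMod p)⸨X⸩ := HahnSeries.single (1 : ℤ) (1 : ZMod p) with hT
  have hvT : Valued.v T = exp (-(1 : ℤ)) := by
    simpa using valuation_single_one_one_zpow (ZMod p) 1
  have hT1 : Valued.v T < (1 : ℤᵐ⁰) := by rw [hvT, ← exp_zero, exp_lt_exp]; decide
  have hT0 : T ≠ 0 := by
    intro h; rw [h, map_zero] at hvT; exact (exp_ne_zero).symm hvT
  -- `z₁`
  obtain ⟨w₁, hw₁⟩ := exists_transcendental_laurentSeries p T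
  obtain ⟨z₁, hz₁v, hz₁⟩ := exists_transcendental_of_valuation_lt p (ZMod p)⟮T⟯
    (mem_adjoin_simple_self (ZMod p) T) hT0 hT1 hw₁
  have hz₁0 : z₁ ≠ 0 := by
    rintro rfl; exact hz₁ (isAlgebraic_zero)
  -- `z₂`
  obtain ⟨w₂, hw₂⟩ := exists_transcendental_laurentSeries p z₁
  obtain ⟨z₂, hz₂v, hz₂⟩ := exists_transcendental_of_valuation_lt p (ZMod p)⟮z₁⟯
    (mem_adjoin_simple_self (ZMod p) z₁) hz₁0 hz₁v hw₂
  refine ⟨z₁, z₂, hz₁v, hz₂v, hz₁0, ?_⟩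
  -- algebraic independence of the pair
  have h1 : AlgebraicIndependent (ZMod p) ![z₁] := by
    rw [algebraicIndependent_singleton_iff (0 : Fin 1)]
    exact hz₁.restrictScalars (algebraMap (ZMod p) (↥(ZMod p)⟮T⟯)).injective
  have h2 : Transcendental (Algebra.adjoin (ZMod p) (Set.range ![z₁])) z₂ := by
    rw [Matrix.range_cons, Matrix.range_empty, Set.union_empty, ← transcendental_adjoin_iff]
    exact hz₂
  have h12 := (AlgebraicIndependent.option_iff (x := ![z₁]) (a := z₂)).mpr ⟨h1, h2⟩
  have he : (![z₁, z₂] : Fin 2 → (ZMod p)⸨X⸩) =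
      (fun o : Option (Fin 1) => o.elim z₂ ![z₁]) ∘ (finSuccEquiv' (1 : Fin 2)) := by
    funext i
    fin_cases i <;> rfl
  rw [he, algebraicIndependent_equiv]
  exact h12

end LaurentModel

section SubfieldModel
variable (p : ℕ) [hp : Fact p.Prime] (K : IntermediateField (ZMod p) ((ZMod p)⸨X⸩))

/-- Constants of `𝔽_p((X))`: `algebraMap 𝔽_p 𝔽_p((X)) c = C c` (through the natural-number cast,
which both maps respect). [folklore] -/
theorem algebraMap_zmod_laurentSeries (c : ZMod p) :
    algebraMap (ZMod p) ((ZMod p)⸨X⸩) c = HahnSeries.C c := by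
  conv_lhs => rw [← ZMod.natCast_zmod_val c]
  rw [map_natCast, ← map_natCast (HahnSeries.C (Γ := ℤ) (R := ZMod p)), ZMod.natCast_zmod_val]

/-- Constants lie in the restricted valuation ring `K ∩ 𝔽_p⟦X⟧`. [folklore] -/
theorem const_mem_comap (c : ZMod p) :
    algebraMap (ZMod p) (↥K) c ∈
      (Valued.v.valuationSubring : ValuationSubring ((ZMod p)⸨X⸩)).comap
        (algebraMap (↥K) ((ZMod p)⸨X⸩)) := by
  rw [ValuationSubring.mem_comap, Valuation.mem_valuationSubring_iff,
    ← IsScalarTower.algebraMap_apply, algebraMap_zmod_laurentSeries]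
  exact valuation_C_le_one (ZMod p) c

/-- The valuation of `K ∩ 𝔽_p⟦X⟧` is equivalent to the restricted `X`-adic valuation. [folklore] -/
theorem isEquiv_comap :
    ((Valued.v : Valuation ((ZMod p)⸨X⸩) ℤᵐ⁰).comap (algebraMap (↥K) ((ZMod p)⸨X⸩))).IsEquiv
      ((Valued.v.valuationSubring : ValuationSubring ((ZMod p)⸨X⸩)).comap
        (algebraMap (↥K) ((ZMod p)⸨X⸩))).valuation := by
  have hO : ((Valued.v : Valuation ((ZMod p)⸨X⸩) ℤᵐ⁰).comap
      (algebraMap (↥K) ((ZMod p)⸨X⸩))).valuationSubring =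
      (Valued.v.valuationSubring : ValuationSubring ((ZMod p)⸨X⸩)).comap
        (algebraMap (↥K) ((ZMod p)⸨X⸩)) := by
    ext x
    rw [Valuation.mem_valuationSubring_iff, ValuationSubring.mem_comap,
      Valuation.mem_valuationSubring_iff, Valuation.comap_apply]
  rw [← hO]
  exact Valuation.isEquiv_valuation_valuationSubring _

/-- `K ∩ 𝔽_p⟦X⟧` is rank one as soon as `K` contains a nonzero element of positive value.
[folklore] -/
theorem rankOne_comap {c : (ZMod p)⸨X⸩} (hcK : c ∈ K) (hc0 : c ≠ 0)
    (hc : Valued.v c < (1 : ℤᵐ⁰)) :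
    Nonempty ((Valued.v.valuationSubring : ValuationSubring ((ZMod p)⸨X⸩)).comap
        (algebraMap (↥K) ((ZMod p)⸨X⸩))).valuation.RankOne := by
  have hE := isEquiv_comap p K
  haveI : ((Valued.v.valuationSubring : ValuationSubring ((ZMod p)⸨X⸩)).comap
      (algebraMap (↥K) ((ZMod p)⸨X⸩))).valuation.IsNontrivial := by
    refine ⟨⟨c, hcK⟩, ?_, ?_⟩
    · rw [Valuation.ne_zero_iff]
      exact fun h => hc0 (congrArg Subtype.val h)
    · intro h1
      have h2 := (hE.symm.eq_one_iff_eq_one).mp h1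
      rw [Valuation.comap_apply, IntermediateField.algebraMap_apply] at h2
      exact hc.ne h2
  rw [Valuation.nonempty_rankOne_iff_mulArchimedean]
  haveI h1 : MulArchimedean (MonoidWithZeroHom.ValueGroup₀ (.ofClass
      ((Valued.v : Valuation ((ZMod p)⸨X⸩) ℤᵐ⁰).comap (algebraMap (↥K) ((ZMod p)⸨X⸩))))) :=
    MulArchimedean.comap MonoidWithZeroHom.ValueGroup₀.embedding.toMonoidHom
      MonoidWithZeroHom.ValueGroup₀.embedding_strictMono
  exact MulArchimedean.comap (hE.symm.orderMonoidIso).toMonoidHom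
    (hE.symm.orderMonoidIso).strictMono

/-- `K ∩ 𝔽_p⟦X⟧` is residually rational (zero-dimensional in the crux's typing): `x ≡ x(0)`.
[folklore] -/
theorem zeroDim_comap :
    ∀ x ∈ (Valued.v.valuationSubring : ValuationSubring ((ZMod p)⸨X⸩)).comap
        (algebraMap (↥K) ((ZMod p)⸨X⸩)),
      ∃ f : Polynomial (ZMod p), f ≠ 0 ∧ Polynomial.aeval x f ∈
        ((Valued.v.valuationSubring : ValuationSubring ((ZMod p)⸨X⸩)).comap
          (algebraMap (↥K) ((ZMod p)⸨X⸩))).nonunits := by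
  intro x hx
  have hvx : Valued.v (algebraMap (↥K) ((ZMod p)⸨X⸩) x) ≤ (1 : ℤᵐ⁰) :=
    (Valuation.mem_valuationSubring_iff _ _).mp (ValuationSubring.mem_comap.mp hx)
  refine ⟨Polynomial.X - Polynomial.C ((algebraMap (↥K) ((ZMod p)⸨X⸩) x).coeff 0),
    Polynomial.X_sub_C_ne_zero _, ?_⟩
  rw [mem_nonunits_comap_iff, mem_nonunits_valuationSubring_iff, map_sub, Polynomial.aeval_X,
    Polynomial.aeval_C, map_sub, ← IsScalarTower.algebraMap_apply,
    algebraMap_zmod_laurentSeries]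
  refine (valuation_sub_C_coeff_zero_le (ZMod p) hvx).trans_lt ?_
  rw [← exp_zero, exp_lt_exp]
  decide

/-- `𝔽_p(S)` is finitely generated over `𝔽_p` (as its own top intermediate field) for finite `S`.
[folklore] -/
theorem fg_top_adjoin {S : Set ((ZMod p)⸨X⸩)} (hS : S.Finite) :
    (⊤ : IntermediateField (ZMod p) (↥(IntermediateField.adjoin (ZMod p) S))).FG :=
  IntermediateField.fg_top_iff.mpr
    (IntermediateField.essFiniteType_iff.mpr (IntermediateField.fg_adjoin_of_finite hS))

end SubfieldModel

/-! ## §3 General position is not automatic; the guard of the axis clause is load-bearing -/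

section Refutations

/-- In the crux's notation: if the FIRST element of a two-element frame lies in `𝔪_O`, then the
frame is not in general position for `g = X₀`: `axis 1 x X₀ = C (x̄₀) = 0`. [folklore] -/
theorem axis_X_zero_eq_zero {k K : Type} [Field k] [Field K] [Algebra k K] (O : ValuationSubring K)
    (hk : ∀ c : k, algebraMap k K c ∈ O) (x : Fin (1 + 1) → O) (h0 : ((x 0 : O) : K) ∈ O.nonunits) :
    MvPolynomial.eval₂ (Polynomial.C.comp ((residue O).comp ((algebraMap k K).codRestrict O hk)))
      (Fin.snoc (fun j => Polynomial.C (residue O (x (Fin.castSucc j)))) Polynomial.X)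
      (MvPolynomial.X 0 : MvPolynomial (Fin (1 + 1)) k) = 0 := by
  rw [MvPolynomial.eval₂_X, show (0 : Fin (1 + 1)) = Fin.castSucc (0 : Fin 1) from rfl,
    Fin.snoc_castSucc]
  exact Polynomial.C_eq_zero.mpr
    ((IsLocalRing.residue_eq_zero_iff _).mpr (ValuationSubring.coe_mem_nonunits_iff.mp h0))

/-- **Re-framing is load-bearing** (the strengthening "the given frame already works: `x' := x`,
`G := g`" is FALSE — general position is NOT automatic): `p = 2`, `K = 𝔽₂(z₁, z₂) ⊆ 𝔽₂((X))`
with the `X`-adic place (`z₁, z₂` algebraically independent Laurent series of positive value),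
`n = 1`, `x = (z₁, z₂)`, `g = X₀`: `axis 1 x g = C(z̄₁) = 0`. [folklore] -/
theorem not_pureTranscendentalFrames_noReframing :
    ¬ (
      ∀ p : ℕ, p.Prime → ∀ (k K : Type) [Field k] [CharP k p] [PerfectField k] [Field K] [Algebra k
      K], (⊤ : IntermediateField k K).FG → ∀ O : ValuationSubring K, ∀ hk : (∀ c : k, algebraMap k K
      c ∈ O), Nonempty O.valuation.RankOne → (∀ x ∈ O, ∃ f : Polynomial k, f ≠ 0 ∧ Polynomial.aeval
      x f ∈ O.nonunits) →
      let ρ : k →+* IsLocalRing.ResidueField O := (IsLocalRing.residue O).comp ((algebraMap k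
          K).codRestrict O hk);
      let axis : (m : ℕ) → (Fin (m + 1) → O) → MvPolynomial (Fin (m + 1)) k → Polynomial
          (IsLocalRing.ResidueField O) := fun _ w g => MvPolynomial.eval₂ (Polynomial.C.comp ρ)
          (Fin.snoc (fun j => Polynomial.C (IsLocalRing.residue O (w (Fin.castSucc j))))
          Polynomial.X) g;
      ∀ (n : ℕ) (x : Fin (n + 1) → O) (g : MvPolynomial (Fin (n + 1)) k), AlgebraicIndependent k
      (fun i => (x i : K)) → g ≠ 0 → axis n x g ≠ 0 ∧
      let K₁ : IntermediateField k K := IntermediateField.adjoin k (Set.range fun j : Fin n => (x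
          (Fin.castSucc j) : K));
      let w : K := (x (Fin.last n) : K);
      ((∃ h ∈ K₁, ∀ a ∈ K₁, O.valuation (w - h) ≤ O.valuation (w - a)) ∨ (∀ q : Polynomial K₁, q ≠ 0
      → ∃ a : K₁, O.valuation (Polynomial.aeval w q - algebraMap K₁ K (Polynomial.eval a q)) <
      O.valuation (Polynomial.aeval w q)))) := by
  intro h
  obtain ⟨z₁, z₂, hz₁v, hz₂v, hz₁0, hind⟩ := exists_frame_laurentSeries 2
  set E : IntermediateField (ZMod 2) ((ZMod 2)⸨X⸩) :=
    IntermediateField.adjoin (ZMod 2) {z₁, z₂} with hE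
  have hz₁E : z₁ ∈ E := IntermediateField.subset_adjoin _ _ (by simp)
  have hz₂E : z₂ ∈ E := IntermediateField.subset_adjoin _ _ (by simp)
  have h1 := h 2 Nat.prime_two (ZMod 2) ↥E (fg_top_adjoin 2 (Set.toFinite _))
    ((Valued.v.valuationSubring : ValuationSubring ((ZMod 2)⸨X⸩)).comap
      (algebraMap ↥E ((ZMod 2)⸨X⸩)))
    (const_mem_comap 2 E) (rankOne_comap 2 E hz₁E hz₁0 hz₁v) (zeroDim_comap 2 E)
  have hmem : ∀ z : (ZMod 2)⸨X⸩, ∀ hz : z ∈ E, Valued.v z < (1 : ℤᵐ⁰) →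
      (⟨z, hz⟩ : ↥E) ∈ (Valued.v.valuationSubring : ValuationSubring ((ZMod 2)⸨X⸩)).comap
        (algebraMap ↥E ((ZMod 2)⸨X⸩)) := by
    intro z hz hv
    rw [ValuationSubring.mem_comap, Valuation.mem_valuationSubring_iff,
      IntermediateField.algebraMap_apply]
    exact hv.le
  let x : Fin (1 + 1) → ↥((Valued.v.valuationSubring : ValuationSubring ((ZMod 2)⸨X⸩)).comap
      (algebraMap ↥E ((ZMod 2)⸨X⸩))) :=
    ![⟨⟨z₁, hz₁E⟩, hmem z₁ hz₁E hz₁v⟩, ⟨⟨z₂, hz₂E⟩, hmem z₂ hz₂E hz₂v⟩]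
  have hx : AlgebraicIndependent (ZMod 2) (fun i => (x i : ↥E)) := by
    refine AlgebraicIndependent.of_comp E.val ?_
    convert hind using 1
    funext i
    fin_cases i <;> rfl
  have hx0 : ((x 0 : ↥((Valued.v.valuationSubring : ValuationSubring ((ZMod 2)⸨X⸩)).comap
      (algebraMap ↥E ((ZMod 2)⸨X⸩)))) : ↥E) ∈
      ((Valued.v.valuationSubring : ValuationSubring ((ZMod 2)⸨X⸩)).comap
        (algebraMap ↥E ((ZMod 2)⸨X⸩))).nonunits := by
    rw [mem_nonunits_comap_iff, mem_nonunits_valuationSubring_iff]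
    exact hz₁v
  obtain ⟨hax, -⟩ := h1 1 x (MvPolynomial.X 0) hx (MvPolynomial.X_ne_zero _)
  exact hax (axis_X_zero_eq_zero _ _ x hx0)

/-- **The guard `axis n x g ≠ 0 →` of the axis-order clause is load-bearing**: Mathlib's
`rootMultiplicity _ 0 = 0`, so the unguarded clause forces `G(x')` to be a unit whenever `x` is
not in general position; at the frame of `not_pureTranscendentalFrames_noReframing` (`g = X₀`,
`G(x') = g(x) = z₁ ∈ 𝔪`) this is impossible, because `axis 1 x' G` evaluated at `x̄'₁` is the
residue of `G(x')` (`eval_residue_axis`). [folklore] -/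
theorem not_pureTranscendentalFrames_unguardedAxis :
    ¬ (
      ∀ p : ℕ, p.Prime → ∀ (k K : Type) [Field k] [CharP k p] [PerfectField k] [Field K] [Algebra k
      K], (⊤ : IntermediateField k K).FG → ∀ O : ValuationSubring K, ∀ hk : (∀ c : k, algebraMap k K
      c ∈ O), Nonempty O.valuation.RankOne → (∀ x ∈ O, ∃ f : Polynomial k, f ≠ 0 ∧ Polynomial.aeval
      x f ∈ O.nonunits) →
      let ρ : k →+* IsLocalRing.ResidueField O := (IsLocalRing.residue O).comp ((algebraMap k
          K).codRestrict O hk);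
      let axis : (m : ℕ) → (Fin (m + 1) → O) → MvPolynomial (Fin (m + 1)) k → Polynomial
          (IsLocalRing.ResidueField O) := fun _ w g => MvPolynomial.eval₂ (Polynomial.C.comp ρ)
          (Fin.snoc (fun j => Polynomial.C (IsLocalRing.residue O (w (Fin.castSucc j))))
          Polynomial.X) g;
      ∀ (n : ℕ) (x : Fin (n + 1) → O) (g : MvPolynomial (Fin (n + 1)) k), AlgebraicIndependent k
      (fun i => (x i : K)) → g ≠ 0 → ∃ (x' : Fin (n + 1) → O) (G : MvPolynomial (Fin (n + 1)) k),
      AlgebraicIndependent k (fun i => (x' i : K)) ∧ (∀ i, (x i : K) ∈ Algebra.adjoin k (Set.range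
      fun i => (x' i : K))) ∧ MvPolynomial.aeval (fun i => (x' i : K)) G = MvPolynomial.aeval (fun i
      => (x i : K)) g ∧ axis n x' G ≠ 0 ∧ (axis n x' G).rootMultiplicity (IsLocalRing.residue O (x'
      (Fin.last n))) ≤ (axis n x g).rootMultiplicity (IsLocalRing.residue O (x (Fin.last n))) ∧
      let K₁ : IntermediateField k K := IntermediateField.adjoin k (Set.range fun j : Fin n => (x'
          (Fin.castSucc j) : K));
      let w : K := (x' (Fin.last n) : K);
      ((∃ h ∈ K₁, ∀ a ∈ K₁, O.valuation (w - h) ≤ O.valuation (w - a)) ∨ (∀ q : Polynomial K₁, q ≠ 0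
      → ∃ a : K₁, O.valuation (Polynomial.aeval w q - algebraMap K₁ K (Polynomial.eval a q)) <
      O.valuation (Polynomial.aeval w q)))) := by
  intro h
  obtain ⟨z₁, z₂, hz₁v, hz₂v, hz₁0, hind⟩ := exists_frame_laurentSeries 2
  set E : IntermediateField (ZMod 2) ((ZMod 2)⸨X⸩) :=
    IntermediateField.adjoin (ZMod 2) {z₁, z₂} with hE
  have hz₁E : z₁ ∈ E := IntermediateField.subset_adjoin _ _ (by simp)
  have hz₂E : z₂ ∈ E := IntermediateField.subset_adjoin _ _ (by simp)
  have h1 := h 2 Nat.prime_two (ZMod 2) ↥E (fg_top_adjoin 2 (Set.toFinite _))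
    ((Valued.v.valuationSubring : ValuationSubring ((ZMod 2)⸨X⸩)).comap
      (algebraMap ↥E ((ZMod 2)⸨X⸩)))
    (const_mem_comap 2 E) (rankOne_comap 2 E hz₁E hz₁0 hz₁v) (zeroDim_comap 2 E)
  have hmem : ∀ z : (ZMod 2)⸨X⸩, ∀ hz : z ∈ E, Valued.v z < (1 : ℤᵐ⁰) →
      (⟨z, hz⟩ : ↥E) ∈ (Valued.v.valuationSubring : ValuationSubring ((ZMod 2)⸨X⸩)).comap
        (algebraMap ↥E ((ZMod 2)⸨X⸩)) := by
    intro z hz hv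
    rw [ValuationSubring.mem_comap, Valuation.mem_valuationSubring_iff,
      IntermediateField.algebraMap_apply]
    exact hv.le
  let x : Fin (1 + 1) → ↥((Valued.v.valuationSubring : ValuationSubring ((ZMod 2)⸨X⸩)).comap
      (algebraMap ↥E ((ZMod 2)⸨X⸩))) :=
    ![⟨⟨z₁, hz₁E⟩, hmem z₁ hz₁E hz₁v⟩, ⟨⟨z₂, hz₂E⟩, hmem z₂ hz₂E hz₂v⟩]
  have hx : AlgebraicIndependent (ZMod 2) (fun i => (x i : ↥E)) := by
    refine AlgebraicIndependent.of_comp E.val ?_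
    convert hind using 1
    funext i
    fin_cases i <;> rfl
  have hx0 : ((x 0 : ↥((Valued.v.valuationSubring : ValuationSubring ((ZMod 2)⸨X⸩)).comap
      (algebraMap ↥E ((ZMod 2)⸨X⸩)))) : ↥E) ∈
      ((Valued.v.valuationSubring : ValuationSubring ((ZMod 2)⸨X⸩)).comap
        (algebraMap ↥E ((ZMod 2)⸨X⸩))).nonunits := by
    rw [mem_nonunits_comap_iff, mem_nonunits_valuationSubring_iff]
    exact hz₁v
  obtain ⟨x', G, hx', -, hG, hax', hmult, -⟩ :=
    h1 1 x (MvPolynomial.X 0) hx (MvPolynomial.X_ne_zero _)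
  -- the right-hand multiplicity is `rootMultiplicity _ 0 = 0`
  have hm0 := Nat.eq_zero_of_le_zero (hmult.trans_eq (by
    beta_reduce
    rw [axis_X_zero_eq_zero _ _ x hx0, Polynomial.rootMultiplicity_zero]))
  rw [Polynomial.rootMultiplicity_eq_zero_iff] at hm0
  refine hax' (hm0 ?_)
  -- `x̄'₁` IS a root of the new axis: its value there is the residue of `G(x') = g(x) = z₁ ∈ 𝔪`
  rw [Polynomial.IsRoot.def, eval_residue_axis, IsLocalRing.residue_eq_zero_iff,
    ← ValuationSubring.coe_mem_nonunits_iff, coe_eval₂_codRestrict, hG, MvPolynomial.aeval_X]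
  exact hx0

end Refutations

end Summit.ResolutionOfSingularities.ResolutionOfSingularities.Theorems.PureTranscendentalFrames.Negative

end
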